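import Summits.CriticalPhenomena.CardyFormulaZ2.Theorems.CardyIKTransportIKLinearTransportStubCutMarkovKernel
import Summits.CriticalPhenomena.CardyFormulaZ2.Theorems.CardyIKTransportIKLinearTransportStubCutMarkovLocalSweep

/-!
# Stub `stub_TwoSidedCutMarkovKernel` (K₂) — part 0: VOCABULARY of the two-cut factorisation

Support file (`--supports stmt-CriticalPhenomena-5076`, lead c2). Definitions only, plus the elementary facts about
the first cut row above `0` and the congruence of the cut predicate.

THE PLAN OF (K₂) (a two-sided environment-local cut-Markov version of the conditional middle-row law, `ReadsEnv` of
`…StubCutMarkovLocalSweep.lean`). Between the LAST cut row `c = cmkCstar ≤ -1` and the FIRST cut row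
`c' = cmkCfirst ≥ 1` of the environment, the version is the CANONICAL ATOM VERSION: the conditional probability of the
middle row `0` given the ATOM of the window data — the environment read on the strip rows `[c-2, c'+2]` exactly as
`EnvAgree` reads it (`tcAtom`) — and the middle rows `(c, 0)` of the past (`tcZev`); these atoms have positive mass, so
no disintegration is involved, and two-sided locality holds by construction. That this IS a version of the conditional
law given the full row statistic is the FACTORISATION IDENTITY `TcFactorisation` (§6): on an atom, the middle row `0` is
independent of the row statistic. It is assembled from
* `TwoCutComb` (§2, combinatorics): the two-cut characterisation `IsCut c ∧ IsCut c' ↔ TcLow ∧ TcWin ∧ TcHigh` (lower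
  half-strip conditions, window conditions, upper half-strip conditions), the assembly of the upper half-diagram at `c`
  from the window reachability and the upper half-diagram at `c'` (`TcComb2`), the rigidity of the window reachability
  among boundary/pivot cells under `EnvAgree`, and the irrelevance of the (bichromatic) cut-row flags;
* `TcGaugeRect` (§4, the cut-adapted gauge `cmkΞ i T c` of `…StubCutMarkovKernelBits.lean`): the pull-back `tcE` of an
  atom is a RECTANGLE — stable under exchanging the inner noise `tcNin` (biased plaquettes of the rows `[c, c')` and coins
  of the rows `(c, c')` of the isotropic face column) between two of its points — on which the middle row `0` reads only
  the inner noise and the row statistic reads only the other coordinates;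
* `TcRectIdentity` (§5, abstract): on a rectangle of a product Bernoulli space, a function of the first block of
  coordinates and a function of the second block are independent.
-/

noncomputable section

namespace Summit.CriticalPhenomena.CardyFormulaZ2.Theorems.IKLinearTransport.PinnedDiagramExchange

open scoped Classical MeasureTheory ENNReal symmDiff
open Set MeasureTheory
open Literature.Probability.Percolation Literature.Probability.LatticeModels

/-! ## §1 The first cut row above row `0` -/

/-- THE FIRST CUT ROW `≥ 1` of an environment (`0` when there is none). [folklore] -/
def cmkCfirst (i : ℤ) (p : Obs × Set (Site 2 × Site 2)) : ℤ :=
  if h : ∃ c : ℤ, 1 ≤ c ∧ IsCut i c p then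
    (Int.leastOfBdd (P := fun c => 1 ≤ c ∧ IsCut i c p) 1 (fun _ hz => hz.1) h : ℤ) else 0

/-- A cut row `≥ 1` lies above the first one, which is a cut row `≥ 1`. [folklore] -/
theorem cmk_cfirst_of_isCut (i : ℤ) {p : Obs × Set (Site 2 × Site 2)} {c : ℤ} (hc : 1 ≤ c) (h : IsCut i c p) :
    1 ≤ cmkCfirst i p ∧ cmkCfirst i p ≤ c ∧ IsCut i (cmkCfirst i p) p := by
  have hex : ∃ c : ℤ, 1 ≤ c ∧ IsCut i c p := ⟨c, hc, h⟩
  rw [cmkCfirst, dif_pos hex]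
  obtain ⟨⟨h1, h2⟩, h3⟩ := (Int.leastOfBdd (P := fun c => 1 ≤ c ∧ IsCut i c p) 1 (fun _ hz => hz.1) hex).2
  exact ⟨h1, h3 c ⟨hc, h⟩, h2⟩

/-- A positive value of `cmkCfirst` is a cut row. [folklore] -/
theorem cmk_isCut_of_cfirst (i : ℤ) {p : Obs × Set (Site 2 × Site 2)} {c : ℤ} (hc : 1 ≤ c) (h : cmkCfirst i p = c) :
    IsCut i c p := by
  by_cases hex : ∃ c : ℤ, 1 ≤ c ∧ IsCut i c p
  · rw [cmkCfirst, dif_pos hex] at h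
    have := (Int.leastOfBdd (P := fun c => 1 ≤ c ∧ IsCut i c p) 1 (fun _ hz => hz.1) hex).2.1.2
    rwa [h] at this
  · rw [cmkCfirst, dif_neg hex] at h; omega

/-- Characterisation of the positive level sets of `cmkCfirst`. [folklore] -/
theorem cmk_cfirst_eq_iff (i : ℤ) (p : Obs × Set (Site 2 × Site 2)) {c : ℤ} (hc : 1 ≤ c) :
    cmkCfirst i p = c ↔ IsCut i c p ∧ ∀ c', 1 ≤ c' → c' < c → ¬ IsCut i c' p := by
  constructor
  · intro h
    refine ⟨cmk_isCut_of_cfirst i hc h, fun c' h1 h2 h3 => ?_⟩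
    have := (cmk_cfirst_of_isCut i h1 h3).2.1; omega
  · rintro ⟨h1, h2⟩
    obtain ⟨h3, h4, h5⟩ := cmk_cfirst_of_isCut i hc h1
    by_contra hne
    exact h2 _ h3 (by omega) h5

/-- Characterisation of the nonpositive level sets of `cmkCfirst`. [folklore] -/
theorem cmk_cfirst_eq_iff' (i : ℤ) (p : Obs × Set (Site 2 × Site 2)) {c : ℤ} (hc : ¬ 1 ≤ c) :
    cmkCfirst i p = c ↔ c = 0 ∧ ∀ c', 1 ≤ c' → ¬ IsCut i c' p := by
  constructor
  · intro h
    by_cases hex : ∃ c : ℤ, 1 ≤ c ∧ IsCut i c p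
    · obtain ⟨h1, -, -⟩ := cmk_cfirst_of_isCut i hex.choose_spec.1 hex.choose_spec.2
      omega
    · rw [cmkCfirst, dif_neg hex] at h
      push Not at hex
      exact ⟨h.symm, hex⟩
  · rintro ⟨rfl, h2⟩
    have hex : ¬ ∃ c : ℤ, 1 ≤ c ∧ IsCut i c p := fun ⟨c, h1, h3⟩ => h2 c h1 h3
    rw [cmkCfirst, dif_neg hex]

/-- `cmkCfirst` is measurable. [folklore] -/
theorem cmk_measurable_cfirst (i : ℤ) : Measurable (cmkCfirst i) := by
  refine measurable_to_countable' fun c => ?_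
  by_cases hc : 1 ≤ c
  · have : cmkCfirst i ⁻¹' {c} = {p | IsCut i c p ∧ ∀ c', 1 ≤ c' → c' < c → ¬ IsCut i c' p} := by
      ext p; simp only [mem_preimage, mem_singleton_iff, mem_setOf_eq, cmk_cfirst_eq_iff i p hc]
    rw [this]
    exact measurableSet_setOf.2 ((measurable_isCut i c).and (Measurable.forall fun c' => Measurable.imp measurable_const
      (Measurable.imp measurable_const (measurable_isCut i c').not)))
  · have : cmkCfirst i ⁻¹' {c} = {p | c = 0 ∧ ∀ c', 1 ≤ c' → ¬ IsCut i c' p} := by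
      ext p; simp only [mem_preimage, mem_singleton_iff, mem_setOf_eq, cmk_cfirst_eq_iff' i p hc]
    rw [this]
    exact measurableSet_setOf.2 (measurable_const.and (Measurable.forall fun c' => Measurable.imp measurable_const
      (measurable_isCut i c').not))

/-! ## §1b Congruence of the cut predicate -/

/-- The cut predicate at `c` reads the environment only on the strip rows `[c-2, c+2]`: it is invariant under
`EnvAgree i lo hi` for `lo ≤ c - 2`, `c + 2 ≤ hi`. [folklore] -/
theorem isCut_congr_envAgree {i lo hi c : ℤ} {p p' : Obs × Set (Site 2 × Site 2)} (h : EnvAgree i lo hi p p')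
    (hlo : lo ≤ c - 2) (hhi : c + 2 ≤ hi) : IsCut i c p ↔ IsCut i c p' := by
  obtain ⟨hcell, hpair⟩ := h
  have e0 : ∀ y : ℤ, lo ≤ y → y ≤ hi → ((![i, y] : Site 2) ∈ p.1.1 ↔ (![i, y] : Site 2) ∈ p'.1.1) := fun y h1 h2 =>
    (hcell ![i, y] (by simp) (by simp) (by simpa using h1) (by simpa using h2)).1
  have e2 : ∀ y : ℤ, lo ≤ y → y ≤ hi → ((![i + 2, y] : Site 2) ∈ p.1.1 ↔ (![i + 2, y] : Site 2) ∈ p'.1.1) :=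
    fun y h1 h2 => (hcell ![i + 2, y] (by simp) (by simp) (by simpa using h1) (by simpa using h2)).1
  have q1 : ((![i, c], ![i + 2, c]) : Site 2 × Site 2) ∈ p.2 ↔ ((![i, c], ![i + 2, c]) : Site 2 × Site 2) ∈ p'.2 :=
    hpair _ (by simp; omega) (by simp; omega) (by simp; omega) (by simp; omega)
  have q2 : ((![i, c - 2], ![i, c + 2]) : Site 2 × Site 2) ∈ p.2 ↔ ((![i, c - 2], ![i, c + 2]) : Site 2 × Site 2) ∈ p'.2 :=
    hpair _ (by simp; omega) (by simp; omega) (by simp; omega) (by simp; omega)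
  unfold IsCut
  rw [e0 c (by omega) (by omega), e0 (c - 2) (by omega) (by omega), e0 (c + 2) (by omega) (by omega), q1, q2]
  constructor
  · rintro ⟨h1, h2⟩
    refine ⟨fun y hy1 hy2 => ?_, h2⟩
    rw [← e0 y (by omega) (by omega), ← e2 y (by omega) (by omega)]; exact h1 y hy1 hy2
  · rintro ⟨h1, h2⟩
    refine ⟨fun y hy1 hy2 => ?_, h2⟩
    rw [e0 y (by omega) (by omega), e2 y (by omega) (by omega)]; exact h1 y hy1 hy2

/-- `EnvAgree` is transitive. [folklore] -/
theorem envAgree_trans {i lo hi : ℤ} {p p' p'' : Obs × Set (Site 2 × Site 2)} (h : EnvAgree i lo hi p p')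
    (h' : EnvAgree i lo hi p' p'') : EnvAgree i lo hi p p'' :=
  ⟨fun w a b c d => ⟨((h.1 w a b c d).1).trans ((h'.1 w a b c d).1), ((h.1 w a b c d).2).trans ((h'.1 w a b c d).2)⟩,
    fun q a b c d => (h.2 q a b c d).trans (h'.2 q a b c d)⟩

/-- Between the same two cut rows and under `EnvAgree` on `[c-2, c'+2]`, the last cut row below `0` and the first cut
row above `0` agree. [folklore] -/
theorem cstar_cfirst_congr_envAgree {i c c' : ℤ} {p p' : Obs × Set (Site 2 × Site 2)} (hc : c ≤ -1) (hc' : 1 ≤ c')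
    (h1 : IsCut i c p) (h2 : IsCut i c' p) (hag : EnvAgree i (c - 2) (c' + 2) p p') : cmkCstar i p = cmkCstar i p' ∧ cmkCfirst i p = cmkCfirst i p' := by
  constructor
  · obtain ⟨hs1, hs2, hs3⟩ := cmk_cstar_of_isCut i hc h1
    rw [eq_comm, cmk_cstar_eq_iff i p' hs1]
    refine ⟨(isCut_congr_envAgree hag (by omega) (by omega)).1 hs3, fun e he1 he2 he3 => ?_⟩
    have he4 : IsCut i e p := (isCut_congr_envAgree hag (by omega) (by omega)).2 he3
    have := (cmk_cstar_of_isCut i he2 he4).2.1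
    omega
  · obtain ⟨hs1, hs2, hs3⟩ := cmk_cfirst_of_isCut i hc' h2
    rw [eq_comm, cmk_cfirst_eq_iff i p' hs1]
    refine ⟨(isCut_congr_envAgree hag (by omega) (by omega)).1 hs3, fun e he1 he2 he3 => ?_⟩
    have he4 : IsCut i e p := (isCut_congr_envAgree hag (by omega) (by omega)).2 he3
    have := (cmk_cfirst_of_isCut i he1 he4).2.1
    omega

/-! ## §2 Two-cut combinatorics: vocabulary and the statement `TwoCutComb` -/

/-- Window reachability among BOUNDARY-OR-PIVOT cells (pivots `(i+1, c)`, `(i+1, c')`) inside the rows `[c, c']`. [folklore] -/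
def cmkRWp (i c c' : ℤ) (x : Obs) : Set (Site 2 × Site 2) :=
  {pq | (cmkBdp i c pq.1 ∨ cmkBdp i c' pq.1) ∧ (cmkBdp i c pq.2 ∨ cmkBdp i c' pq.2) ∧ pq ∈ cmkRW i c c' x}

/-- LOWER HALF-STRIP CONDITIONS of a cut at `c` (pattern; `(i,c) ≁ (i+2,c)` and `(i,c-2) ∼ pivot` below `c`). [folklore] -/
def TcLow (i c : ℤ) (x : Obs) : Prop :=
  cmkPattern i c x ∧ ((![i, c], ![i + 2, c]) : Site 2 × Site 2) ∉ cmkLoR i c x ∧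
    ((![i, c - 2], ![i + 1, c]) : Site 2 × Site 2) ∈ cmkLoR i c x

/-- UPPER HALF-STRIP CONDITIONS of a cut at `c'` (pattern; `(i,c') ≁ (i+2,c')` and `pivot ∼ (i,c'+2)` above `c'`,
read with the row-`c'` flags set). [folklore] -/
def TcHigh (i c' : ℤ) (x : Obs) : Prop :=
  cmkPattern i c' x ∧ ((![i, c'], ![i + 2, c']) : Site 2 × Site 2) ∉ cmkUpR i c' (cmkFlat i c' x) ∧
    ((![i + 1, c'], ![i, c' + 2]) : Site 2 × Site 2) ∈ cmkUpR i c' (cmkFlat i c' x)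

/-- WINDOW CONDITIONS of the pair of cuts `c < c'` (the window parts of both cut predicates, read inside the rows
`[c, c']` with the row-`c` flags set). [folklore] -/
def TcWin (i c c' : ℤ) (x : Obs) : Prop :=
  ((![i, c], ![i + 2, c]) : Site 2 × Site 2) ∉ cmkRW i c c' (cmkFlat i c x) ∧
    ((![i + 1, c], ![i, c + 2]) : Site 2 × Site 2) ∈ cmkRW i c c' (cmkFlat i c x) ∧
    ((![i, c'], ![i + 2, c']) : Site 2 × Site 2) ∉ cmkRW i c c' (cmkFlat i c x) ∧
    ((![i, c' - 2], ![i + 1, c']) : Site 2 × Site 2) ∈ cmkRW i c c' (cmkFlat i c x)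

/-- ASSEMBLY of the upper half-diagram with pivot at `c` from the window reachability `L` (rows `[c, c']`) and the
upper half-diagram with pivot at `c'` (`U`): the mirror image of `cmkComb`. [folklore] -/
def TcComb2 (i c c' : ℤ) (L U : Set (Site 2 × Site 2)) : Set (Site 2 × Site 2) :=
  {pq | cmkBdp i c pq.1 ∧ cmkBdp i c pq.2 ∧
    ((pq.1 1 ≤ c' ∧ pq.2 1 ≤ c' ∧ pq ∈ L) ∨ (c' ≤ pq.1 1 ∧ c' ≤ pq.2 1 ∧ pq ∈ U) ∨
     (∃ X : Site 2, X 1 = c' ∧ (pq.1, X) ∈ L ∧ (X, pq.2) ∈ U) ∨ (∃ X : Site 2, X 1 = c' ∧ (pq.1, X) ∈ U ∧ (X, pq.2) ∈ L))}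

/-- THE TWO-CUT COMBINATORICS (statement the line posits; stub `stub_TwoCutComb : ∀ i, TwoCutComb i`). For cut rows
`c ≤ -1` and `c' ≥ 1` of the pinned statistic of a configuration `x`:
(C) the pair of cut predicates is EQUIVALENT to the conjunction of lower, window and upper conditions;
(D) the upper half-diagram with pivot at `c` is ASSEMBLED from the boundary/pivot window reachability and the upper
    half-diagram with pivot at `c'`;
(B) the boundary/pivot window reachability is RIGID under `EnvAgree` on `[c-2, c'+2]` between two such configurations;
(E) the row-`c` flags are irrelevant to the window reachability (bichromatic faces). [folklore] -/
def TwoCutComb (i : ℤ) : Prop :=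
  (∀ (c c' : ℤ) (x : Obs), c ≤ -1 → 1 ≤ c' →
    (IsCut i c (pinnedStat i x) ∧ IsCut i c' (pinnedStat i x) ↔ TcLow i c x ∧ TcWin i c c' x ∧ TcHigh i c' x)) ∧
  (∀ (c c' : ℤ) (x : Obs), c ≤ -1 → 1 ≤ c' → IsCut i c (pinnedStat i x) → IsCut i c' (pinnedStat i x) →
    cmkUpDp i c x = TcComb2 i c c' (cmkRWp i c c' x) (cmkUpDp i c' x)) ∧
  (∀ (c c' : ℤ) (x x' : Obs), c ≤ -1 → 1 ≤ c' → IsCut i c (pinnedStat i x) → IsCut i c' (pinnedStat i x) →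
    IsCut i c (pinnedStat i x') → IsCut i c' (pinnedStat i x') →
    EnvAgree i (c - 2) (c' + 2) (pinnedStat i x) (pinnedStat i x') → cmkRWp i c c' x = cmkRWp i c c' x') ∧
  (∀ (c c' : ℤ) (x : Obs), c ≤ -1 → 1 ≤ c' → IsCut i c (pinnedStat i x) → IsCut i c' (pinnedStat i x) →
    cmkRW i c c' (cmkFlat i c x) = cmkRW i c c' x)

/-! ## §3 Atoms of the window data and of the past -/

/-- THE ATOM of the window data of the environment value `p`: environments with the same last cut row `c` below `0`,
the same first cut row `c'` above `0`, and agreeing with `p` on the strip rows `[c-2, c'+2]` as `EnvAgree` reads them.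
[folklore] -/
def tcAtom (i : ℤ) (p : Obs × Set (Site 2 × Site 2)) : Set Obs :=
  {x | cmkCstar i (pinnedStat i x) = cmkCstar i p ∧ cmkCfirst i (pinnedStat i x) = cmkCfirst i p ∧
    EnvAgree i (cmkCstar i p - 2) (cmkCfirst i p + 2) (pinnedStat i x) p}

/-- THE ATOM OF THE PAST above the cut row `c`: configurations whose middle cells and strip faces of the rows
`(c, 0)` are those of `z`. [folklore] -/
def tcZev (i c : ℤ) (z : Obs) : Set Obs :=
  {x | ∀ w : Site 2, c + 1 ≤ w 1 → w 1 ≤ -1 →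
    (w 0 = i + 1 → (w ∈ x.1 ↔ w ∈ z.1)) ∧ ((w 0 = i ∨ w 0 = i + 1) → (w ∈ x.2 ↔ w ∈ z.2))}

/-! ## §4 The rectangle property in the cut-adapted gauge: statement `TcGaugeRect` -/

/-- THE INNER NOISE between the cut rows `c < c'`: biased plaquettes of the isotropic face column of the rows
`[c, c')` and its coins of the rows `(c, c')` (coded indices of `…StubCutMarkovKernelBits.lean`). [folklore] -/
def tcNin (i : ℤ) (τ : Bool) (c c' : ℤ) : Set SDE.JIdx :=
  {j | (∃ s : ℤ, c ≤ s ∧ s < c' ∧ j = jBP ![SDE.isoC i τ, s]) ∨ (∃ y : ℤ, c < y ∧ y < c' ∧ j = jCO ![SDE.isoC i τ, y])}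

/-- The pull-back of an atom (window data of `p`, past `z` above the last cut of `p`) to the coded bits through the
gauge `cmkΞ i T c` anchored at the last cut row `c = cmkCstar i p`. [folklore] -/
def tcE (i : ℤ) (T : Set ℤ) (p : Obs × Set (Site 2 × Site 2)) (z : Obs) : Set SDE.KJ :=
  (cmkΞ i T (cmkCstar i p)) ⁻¹' (tcAtom i p ∩ tcZev i (cmkCstar i p) z)

/-- THE RECTANGLE PROPERTY (statement the line posits; stub
`stub_TwoCutGauge : ∀ i T, (i ∈ T ↔ i + 1 ∉ T) → TwoCutComb i → TcGaugeRect i T`). For an environment value `p` with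
a cut below and a cut above row `0` and a past `z`, in the gauge anchored at the last cut: (R1) the pull-back `tcE` of
the atom is stable under importing the inner noise of another of its points; (R2) on it the middle row `0` reads only
the inner noise; (R3) on it the row statistic reads only the other coordinates. [folklore] -/
def TcGaugeRect (i : ℤ) (T : Set ℤ) : Prop :=
  ∀ (p : Obs × Set (Site 2 × Site 2)) (z : Obs), cmkCstar i p ≤ -1 → 1 ≤ cmkCfirst i p →
    (∀ g g' : SDE.KJ, g ∈ tcE i T p z → g' ∈ tcE i T p z →
      SDE.glue (tcNin i (decide (i ∈ T)) (cmkCstar i p) (cmkCfirst i p)) g g' ∈ tcE i T p z) ∧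
    (∀ g g' : SDE.KJ, g ∈ tcE i T p z → g' ∈ tcE i T p z →
      (∀ j ∈ tcNin i (decide (i ∈ T)) (cmkCstar i p) (cmkCfirst i p), g j = g' j) →
      rowBool i (cmkΞ i T (cmkCstar i p) g) = rowBool i (cmkΞ i T (cmkCstar i p) g')) ∧
    (∀ g g' : SDE.KJ, g ∈ tcE i T p z → g' ∈ tcE i T p z →
      (∀ j ∉ tcNin i (decide (i ∈ T)) (cmkCstar i p) (cmkCfirst i p), g j = g' j) →
      rowStat i (cmkΞ i T (cmkCstar i p) g) = rowStat i (cmkΞ i T (cmkCstar i p) g'))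

/-! ## §5 The abstract rectangle identity: statement `TcRectIdentity` -/

/-- THE ABSTRACT RECTANGLE IDENTITY along the coordinate set `A` (statement the line posits; stub
`stub_RectIdentity : ∀ A, TcRectIdentity A`). On a
measurable set `E` of the product Bernoulli space `SDE.PJ` which is stable under importing the coordinates in `A` from
another of its points, a function `Y` of the `A`-coordinates (on `E`) and a function `R` of the other coordinates
(on `E`) are independent: `P(E ∩ R⁻¹B ∩ Y⁻¹y) · P(E) = P(E ∩ Y⁻¹y) · P(E ∩ R⁻¹B)`. [folklore] -/
def TcRectIdentity (A : Set SDE.JIdx) : Prop :=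
  ∀ (E : Set SDE.KJ), MeasurableSet E →
    (∀ g g' : SDE.KJ, g ∈ E → g' ∈ E → SDE.glue A g g' ∈ E) →
    ∀ (Y : SDE.KJ → Bool × Bool × Bool) (R : SDE.KJ → (Obs × Set (Site 2 × Site 2)) × Obs),
      Measurable Y → Measurable R →
      (∀ g g' : SDE.KJ, g ∈ E → g' ∈ E → (∀ j ∈ A, g j = g' j) → Y g = Y g') →
      (∀ g g' : SDE.KJ, g ∈ E → g' ∈ E → (∀ j ∉ A, g j = g' j) → R g = R g') →
      ∀ (B : Set ((Obs × Set (Site 2 × Site 2)) × Obs)), MeasurableSet B → ∀ y : Bool × Bool × Bool,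
        SDE.PJ (E ∩ R ⁻¹' B ∩ Y ⁻¹' {y}) * SDE.PJ E = SDE.PJ (E ∩ Y ⁻¹' {y}) * SDE.PJ (E ∩ R ⁻¹' B)

/-! ## §6 The factorisation identity (K₂b) -/

/-- THE FACTORISATION IDENTITY ON ATOMS (assembled by the lead from `TcGaugeRect` and `TcRectIdentity`): under
`νmix T`, on the atom of (window data of `p`, past `z` above the last cut of `p`), the middle row `0` is independent of
the row statistic. [folklore] -/
def TcFactorisation (i : ℤ) (T : Set ℤ) : Prop :=
  ∀ (p : Obs × Set (Site 2 × Site 2)) (z : Obs), cmkCstar i p ≤ -1 → 1 ≤ cmkCfirst i p →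
    ∀ (A : Set ((Obs × Set (Site 2 × Site 2)) × Obs)), MeasurableSet A → ∀ y : Bool × Bool × Bool,
      νmix T ({x | rowStat i x ∈ A} ∩ (tcAtom i p ∩ tcZev i (cmkCstar i p) z) ∩ {x | rowBool i x = y}) *
          νmix T (tcAtom i p ∩ tcZev i (cmkCstar i p) z) =
        νmix T ((tcAtom i p ∩ tcZev i (cmkCstar i p) z) ∩ {x | rowBool i x = y}) *
          νmix T ({x | rowStat i x ∈ A} ∩ (tcAtom i p ∩ tcZev i (cmkCstar i p) z))

/-! ## §7 Measurability of the atoms -/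

/-- The atom of the window data is a measurable set of configurations. [folklore] -/
theorem measurableSet_tcAtom (i : ℤ) (p : Obs × Set (Site 2 × Site 2)) : MeasurableSet (tcAtom i p) := by
  have hps := measurable_pinnedStat i
  have hcell : ∀ v : Site 2, Measurable fun x : Obs => v ∈ (pinnedStat i x).1.1 := fun v =>
    (measurable_set_mem v).comp (measurable_fst.comp (measurable_fst.comp hps))
  have hface : ∀ v : Site 2, Measurable fun x : Obs => v ∈ (pinnedStat i x).1.2 := fun v =>
    (measurable_set_mem v).comp (measurable_snd.comp (measurable_fst.comp hps))
  have hpair : ∀ q : Site 2 × Site 2, Measurable fun x : Obs => q ∈ (pinnedStat i x).2 := fun q =>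
    (measurable_set_mem q).comp (measurable_snd.comp hps)
  refine (measurableSet_eq_fun ((cmk_measurable_cstar i).comp hps) measurable_const).inter
    ((measurableSet_eq_fun ((cmk_measurable_cfirst i).comp hps) measurable_const).inter (measurableSet_setOf.2 ?_))
  refine (Measurable.forall fun w => Measurable.imp measurable_const (Measurable.imp measurable_const
    (Measurable.imp measurable_const (Measurable.imp measurable_const
      (((hcell w).iff measurable_const).and ((hface w).iff measurable_const)))))).and
    (Measurable.forall fun q => Measurable.imp measurable_const (Measurable.imp measurable_const
      (Measurable.imp measurable_const (Measurable.imp measurable_const ((hpair q).iff measurable_const)))))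

/-- The atom of the past is a measurable set of configurations. [folklore] -/
theorem measurableSet_tcZev (i c : ℤ) (z : Obs) : MeasurableSet (tcZev i c z) := by
  have hcell : ∀ v : Site 2, Measurable fun x : Obs => v ∈ x.1 := fun v => (measurable_set_mem v).comp measurable_fst
  have hface : ∀ v : Site 2, Measurable fun x : Obs => v ∈ x.2 := fun v => (measurable_set_mem v).comp measurable_snd
  refine measurableSet_setOf.2 (Measurable.forall fun w => Measurable.imp measurable_const (Measurable.imp measurable_const
    ((Measurable.imp measurable_const ((hcell w).iff measurable_const)).and
      (Measurable.imp measurable_const ((hface w).iff measurable_const)))))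

/-- The pull-back `tcE` of an atom is measurable (registered sub-goal `measurableSet_tcE`). [folklore] -/
theorem measurableSet_tcE : ∀ (i : ℤ) (T : Set ℤ) (p : Obs × Set (Site 2 × Site 2)) (z : Obs), MeasurableSet (tcE i T p z) :=
  fun i T p z => (cmk_measurable_Ξ i T _) ((measurableSet_tcAtom i p).inter (measurableSet_tcZev i _ z))

end Summit.CriticalPhenomena.CardyFormulaZ2.Theorems.IKLinearTransport.PinnedDiagramExchange
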